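import Summits.NavierStokesRegularity.NavierStokesRegularity.Theses.SymmetryModuliCount
import Literature.Analysis.FluidPDE.OseenKernelLineIntegrals
import Literature.Analysis.UnboundedOperators.HeatKernelFourier

/-!
# Crux `SymmetricLiouville` (stmt-NavierStokesRegularity-4053), negative side: "ancient" is load-bearing

Negative-side (cdisprove, D-0016) support lemmas extracted from
`Cruxes/SymmetricLiouville/Disproof.lean` v3 of route `SymmetryModuliCount`. The crux says: a smooth,
divergence-free, KNSS-mild ANCIENT field on `(−∞,0) × ℝ³` with Type-I time decay
`‖u(t,x)‖ ≤ C/√(−t)` which is annihilated by the generator of a nonzero `ξ ∈ sim(3)` vanishes.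

Here "ancient" is shown to be load-bearing: `SymmetricLiouvilleOnWindow T` — the same statement with
all hypotheses, the symmetry and the conclusion restricted to a FINITE backward window `(−T, 0)` — is
FALSE for every `T > 0` (`symmetricLiouville_false_on_window`). The witness is the viscous shear wave
(Kolmogorov mode) `u(t, y) = e^{−4π²t} sin(2π y₀) e₁`, an exact Navier–Stokes solution with vanishing
nonlinearity: it is smooth, divergence free, satisfies the KNSS/Oseen integral equation between ANY
two times (`shearWave_mild`: the heat flow of a plane wave, `heatExtension_shear`, from the tree's
`fourierIntegral_heatKernel_holds`; and the vanishing of the Oseen–Duhamel term on tensors independent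
of the divergence coordinate, the tree's `integral_oseenKernel_sub_smul_single_left`), is Type-I on
the window with `C = e^{4π²T}√T`, is invariant under translations along `e₁`, and is nonzero. It is
not a counterexample to the crux only because it grows like `e^{4π²|t|}` as `t → −∞`: any proof of
the crux must use the behaviour of `u` as `t → −∞`, not merely the equation and the rate near `t = 0`.

No route statement is changed (`--supports`).
-/

noncomputable section

namespace Summit.NavierStokesRegularity.NavierStokesRegularity.Theorems.SymmetricLiouville.Negative

open Literature.Analysis.FluidPDE Literature.Analysis.UnboundedOperators MeasureTheory Set Function
open scoped RealInnerProductSpace FourierTransform Real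

/-- Unit vector along Lean coordinate `1` (direction of the shear velocity). -/
def e1 : (EuclideanSpace ℝ (Fin 3)) := EuclideanSpace.single 1 1

/-- Unit vector along Lean coordinate `0` (direction of the shear wave vector). -/
def f0 : (EuclideanSpace ℝ (Fin 3)) := EuclideanSpace.single 0 1

/-- `‖e₁‖ = 1`. -/
theorem norm_e1 : ‖e1‖ = 1 := by simp [e1]

/-- `‖f₀‖ = 1`. -/
theorem norm_f0 : ‖f0‖ = 1 := by simp [f0]

/-- `⟪v, f₀⟫ = v₀`. -/
theorem inner_f0 (v : (EuclideanSpace ℝ (Fin 3))) : ⟪v, f0⟫ = v 0 := by simp [f0, EuclideanSpace.inner_single_right]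

/-- `e₁ ≠ 0`. -/
theorem e1_ne_zero : e1 ≠ 0 := by
  intro h
  have := norm_e1
  rw [h, norm_zero] at this
  exact zero_ne_one this

/-- `e₁` has vanishing `0`-th coordinate. -/
theorem e1_apply_zero : e1 0 = 0 := by simp [e1]

/-- Continuity of `v ↦ v₀` on `ℝ³`. -/
theorem continuous_coord0 : Continuous fun v : (EuclideanSpace ℝ (Fin 3)) => v 0 :=
  (EuclideanSpace.proj (0 : Fin 3) : (EuclideanSpace ℝ (Fin 3)) →L[ℝ] ℝ).continuous

/-! ### The Gauss–Weierstrass kernel against the plane wave `e^{2πi y₀}` -/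

/-- `𝓕 G_σ (f₀) = e^{−4π²σ}` written out: `∫ e^{−2πi v₀} G_σ(v) dv = e^{−4π²σ}`. -/
theorem fourier_heatKernel_f0 {σ : ℝ} (hσ : 0 < σ) :
    ∫ v : (EuclideanSpace ℝ (Fin 3)), Complex.exp (↑(-2 * π * v 0) * Complex.I) • (heatKernel σ v : ℂ) =
      (Real.exp (-(4 * π ^ 2 * σ)) : ℂ) := by
  have hF := fourierIntegral_heatKernel_holds (E := (EuclideanSpace ℝ (Fin 3))) hσ f0
  rw [Real.fourier_eq'] at hF
  simp only [inner_f0] at hF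
  rw [hF, heatSymbol, norm_f0]
  push_cast
  ring_nf

/-- Integrability of the Fourier integrand. -/
theorem integrable_cexp_smul_heatKernel {σ : ℝ} (hσ : 0 < σ) :
    Integrable (fun v : (EuclideanSpace ℝ (Fin 3)) => Complex.exp (↑(-2 * π * v 0) * Complex.I) • (heatKernel σ v : ℂ)) := by
  have hG : Integrable (fun v : (EuclideanSpace ℝ (Fin 3)) => (heatKernel σ v : ℂ)) :=
    (integrable_heatKernel_holds (E := (EuclideanSpace ℝ (Fin 3))) hσ).ofReal
  have h1 : Continuous fun v : (EuclideanSpace ℝ (Fin 3)) => Complex.exp (↑(-2 * π * v 0) * Complex.I) :=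
    Complex.continuous_exp.comp
      ((Complex.continuous_ofReal.comp (continuous_const.mul continuous_coord0)).mul
        continuous_const)
  have h2 : Continuous fun v : (EuclideanSpace ℝ (Fin 3)) => (heatKernel σ v : ℂ) :=
    Complex.continuous_ofReal.comp (continuous_heatKernel (E := (EuclideanSpace ℝ (Fin 3))) σ)
  refine hG.norm.mono' (h1.smul h2).aestronglyMeasurable (Filter.Eventually.of_forall fun v => ?_)
  rw [norm_smul, Complex.norm_exp_ofReal_mul_I, one_mul]

/-- `∫ G_σ(v) cos(2π v₀) dv = e^{−4π²σ}` (real part of `fourier_heatKernel_f0`). -/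
theorem integral_heatKernel_mul_cos {σ : ℝ} (hσ : 0 < σ) :
    ∫ v : (EuclideanSpace ℝ (Fin 3)), heatKernel σ v * Real.cos (2 * π * v 0) = Real.exp (-(4 * π ^ 2 * σ)) := by
  have h := congrArg Complex.re (fourier_heatKernel_f0 hσ)
  have h2 := integral_re (integrable_cexp_smul_heatKernel hσ)
  simp only [RCLike.re_to_complex] at h2
  rw [← h2] at h
  have hre : ∀ v : (EuclideanSpace ℝ (Fin 3)), (Complex.exp (↑(-2 * π * v 0) * Complex.I) • (heatKernel σ v : ℂ)).re =
      heatKernel σ v * Real.cos (2 * π * v 0) := by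
    intro v
    rw [smul_eq_mul, Complex.mul_re, Complex.exp_ofReal_mul_I_re, Complex.exp_ofReal_mul_I_im,
      Complex.ofReal_re, Complex.ofReal_im, mul_zero, sub_zero]
    rw [show -2 * π * v 0 = -(2 * π * v 0) by ring, Real.cos_neg, mul_comm]
  simp_rw [hre] at h
  rw [h, Complex.ofReal_re]

/-- `∫ G_σ(v) sin(2π v₀) dv = 0` (imaginary part of `fourier_heatKernel_f0`). -/
theorem integral_heatKernel_mul_sin {σ : ℝ} (hσ : 0 < σ) :
    ∫ v : (EuclideanSpace ℝ (Fin 3)), heatKernel σ v * Real.sin (2 * π * v 0) = 0 := by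
  have h := congrArg Complex.im (fourier_heatKernel_f0 hσ)
  have h2 := integral_im (integrable_cexp_smul_heatKernel hσ)
  simp only [RCLike.im_to_complex] at h2
  rw [← h2] at h
  have him : ∀ v : (EuclideanSpace ℝ (Fin 3)), (Complex.exp (↑(-2 * π * v 0) * Complex.I) • (heatKernel σ v : ℂ)).im =
      -(heatKernel σ v * Real.sin (2 * π * v 0)) := by
    intro v
    rw [smul_eq_mul, Complex.mul_im, Complex.exp_ofReal_mul_I_re, Complex.exp_ofReal_mul_I_im,
      Complex.ofReal_re, Complex.ofReal_im, mul_zero, zero_add]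
    rw [show -2 * π * v 0 = -(2 * π * v 0) by ring, Real.sin_neg]
    ring
  simp_rw [him] at h
  rw [integral_neg, Complex.ofReal_im, neg_eq_zero] at h
  exact h

/-- `G_σ · φ` is integrable for a continuous `φ` with `|φ| ≤ 1`. -/
theorem integrable_heatKernel_mul {σ : ℝ} (hσ : 0 < σ) {φ : (EuclideanSpace ℝ (Fin 3)) → ℝ} (hφ : Continuous φ)
    (hb : ∀ v, |φ v| ≤ 1) : Integrable (fun v : (EuclideanSpace ℝ (Fin 3)) => heatKernel σ v * φ v) := by
  refine (integrable_heatKernel_holds (E := (EuclideanSpace ℝ (Fin 3))) hσ).norm.mono'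
    ((continuous_heatKernel σ).mul hφ).aestronglyMeasurable (Filter.Eventually.of_forall fun v => ?_)
  rw [norm_mul, Real.norm_eq_abs, Real.norm_eq_abs]
  calc |heatKernel σ v| * |φ v| ≤ |heatKernel σ v| * 1 := by gcongr; exact hb v
    _ = |heatKernel σ v| := mul_one _

/-- **Heat flow of the shear mode**: `e^{σΔ}[(c sin(2π y₀)) e₁](x) = c e^{−4π²σ} sin(2π x₀) e₁`. -/
theorem heatExtension_shear {σ : ℝ} (hσ : 0 < σ) (c : ℝ) (x : (EuclideanSpace ℝ (Fin 3))) :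
    heatExtension (fun y : (EuclideanSpace ℝ (Fin 3)) => (c * Real.sin (2 * π * y 0)) • e1) σ x =
      (c * Real.exp (-(4 * π ^ 2 * σ)) * Real.sin (2 * π * x 0)) • e1 := by
  rw [heatExtension_apply]
  simp_rw [smul_smul]
  rw [integral_smul_const]
  congr 1
  have hsplit : ∀ y : (EuclideanSpace ℝ (Fin 3)), heatKernel σ y * (c * Real.sin (2 * π * (x - y) 0)) =
      c * Real.sin (2 * π * x 0) * (heatKernel σ y * Real.cos (2 * π * y 0)) -
        c * Real.cos (2 * π * x 0) * (heatKernel σ y * Real.sin (2 * π * y 0)) := by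
    intro y
    rw [PiLp.sub_apply, mul_sub, Real.sin_sub]
    ring
  simp_rw [hsplit]
  have hc : Integrable fun v : (EuclideanSpace ℝ (Fin 3)) => heatKernel σ v * Real.cos (2 * π * v 0) :=
    integrable_heatKernel_mul hσ (Real.continuous_cos.comp (continuous_const.mul continuous_coord0))
      fun v => Real.abs_cos_le_one _
  have hs : Integrable fun v : (EuclideanSpace ℝ (Fin 3)) => heatKernel σ v * Real.sin (2 * π * v 0) :=
    integrable_heatKernel_mul hσ (Real.continuous_sin.comp (continuous_const.mul continuous_coord0))
      fun v => Real.abs_sin_le_one _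
  rw [integral_sub (hc.const_mul _) (hs.const_mul _), integral_const_mul, integral_const_mul,
    integral_heatKernel_mul_cos hσ, integral_heatKernel_mul_sin hσ]
  ring

/-! ### The decaying viscous shear wave -/

/-- The **viscous shear wave** (Kolmogorov mode) `u(t, y) = e^{−4π²t} sin(2π y₀) e₁`, an exact
smooth divergence-free Navier–Stokes solution on all of `ℝ × ℝ³` (`(u·∇)u = 0`, `p = const`),
invariant under translations along `e₁` and `e₂`, and growing like `e^{4π²|t|}` as `t → −∞`. -/
def shearWave : ℝ → (EuclideanSpace ℝ (Fin 3)) → (EuclideanSpace ℝ (Fin 3)) := fun t y =>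
  (Real.exp (-(4 * π ^ 2 * t)) * Real.sin (2 * π * y 0)) • e1

/-- The shear wave is jointly smooth (everywhere). -/
theorem shearWave_contDiff : ContDiff ℝ (⊤ : ℕ∞) (Function.uncurry shearWave) := by
  have h1 : ContDiff ℝ (⊤ : ℕ∞) (fun p : ℝ × (EuclideanSpace ℝ (Fin 3)) => Real.exp (-(4 * π ^ 2 * p.1))) :=
    Real.contDiff_exp.comp (contDiff_const.mul contDiff_fst).neg
  have h2 : ContDiff ℝ (⊤ : ℕ∞) (fun p : ℝ × (EuclideanSpace ℝ (Fin 3)) => Real.sin (2 * π * p.2 0)) :=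
    Real.contDiff_sin.comp (contDiff_const.mul
      ((EuclideanSpace.proj (0 : Fin 3) : (EuclideanSpace ℝ (Fin 3)) →L[ℝ] ℝ).contDiff.comp contDiff_snd))
  exact (h1.mul h2).smul contDiff_const

/-- The Fréchet derivative of a slice of the shear wave. -/
theorem hasFDerivAt_shearWave (t : ℝ) (y : (EuclideanSpace ℝ (Fin 3))) :
    HasFDerivAt (shearWave t)
      ((Real.exp (-(4 * π ^ 2 * t)) • (Real.cos (2 * π * y 0) •
        ((2 * π) • (EuclideanSpace.proj (0 : Fin 3) : (EuclideanSpace ℝ (Fin 3)) →L[ℝ] ℝ)))).smulRight e1) y := by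
  have h0 : HasFDerivAt (fun v : (EuclideanSpace ℝ (Fin 3)) => v 0) (EuclideanSpace.proj (0 : Fin 3) : (EuclideanSpace ℝ (Fin 3)) →L[ℝ] ℝ) y :=
    (EuclideanSpace.proj (0 : Fin 3) : (EuclideanSpace ℝ (Fin 3)) →L[ℝ] ℝ).hasFDerivAt
  have h1 : HasFDerivAt (fun v : (EuclideanSpace ℝ (Fin 3)) => 2 * π * v 0)
      ((2 * π) • (EuclideanSpace.proj (0 : Fin 3) : (EuclideanSpace ℝ (Fin 3)) →L[ℝ] ℝ)) y := h0.const_mul (2 * π)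
  have h2 : HasFDerivAt (fun v : (EuclideanSpace ℝ (Fin 3)) => Real.sin (2 * π * v 0))
      (Real.cos (2 * π * y 0) • ((2 * π) • (EuclideanSpace.proj (0 : Fin 3) : (EuclideanSpace ℝ (Fin 3)) →L[ℝ] ℝ))) y :=
    (Real.hasDerivAt_sin _).comp_hasFDerivAt y h1
  have h3 := (h2.const_mul (Real.exp (-(4 * π ^ 2 * t)))).smul_const e1
  exact h3

/-- The slice derivative, evaluated. -/
theorem fderiv_shearWave_apply (t : ℝ) (y v : (EuclideanSpace ℝ (Fin 3))) :
    fderiv ℝ (shearWave t) y v =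
      (Real.exp (-(4 * π ^ 2 * t)) * (Real.cos (2 * π * y 0) * (2 * π * v 0))) • e1 := by
  rw [(hasFDerivAt_shearWave t y).fderiv]
  simp [ContinuousLinearMap.smulRight_apply, mul_assoc]

/-- The shear wave is divergence free (its velocity is along `e₁`, its gradient along `f₀ ⊥ e₁`). -/
theorem shearWave_divFree (t : ℝ) : VectorCalculus.IsDivFree (shearWave t) := by
  intro y
  rw [divergence_eq_sum_inner_fderiv (EuclideanSpace.basisFun (Fin 3) ℝ) (shearWave t) y,
    Fin.sum_univ_three]
  simp [fderiv_shearWave_apply, e1, EuclideanSpace.inner_single_left, inner_smul_right]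

/-- The shear wave is invariant under translations along `e₁`: `e₁·∇u = 0`. -/
theorem shearWave_symm (t : ℝ) (y : (EuclideanSpace ℝ (Fin 3))) :
    fderiv ℝ (shearWave t) y (e1 + (0 : ℝ) • y + (0 : (EuclideanSpace ℝ (Fin 3)) →L[ℝ] (EuclideanSpace ℝ (Fin 3))) y) + (0 : ℝ) • shearWave t y +
      (2 * (0 : ℝ) * t) • timeDeriv shearWave t y - (0 : (EuclideanSpace ℝ (Fin 3)) →L[ℝ] (EuclideanSpace ℝ (Fin 3))) (shearWave t y) = 0 := by
  simp [fderiv_shearWave_apply, e1_apply_zero]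

/-- Size of the shear wave: `‖u(t, y)‖ ≤ e^{−4π²t}`. -/
theorem norm_shearWave_le (t : ℝ) (y : (EuclideanSpace ℝ (Fin 3))) : ‖shearWave t y‖ ≤ Real.exp (-(4 * π ^ 2 * t)) := by
  simp only [shearWave, norm_smul, norm_e1, mul_one, norm_mul, Real.norm_eq_abs,
    abs_of_pos (Real.exp_pos _)]
  calc Real.exp (-(4 * π ^ 2 * t)) * |Real.sin (2 * π * y 0)|
      ≤ Real.exp (-(4 * π ^ 2 * t)) * 1 := by gcongr; exact Real.abs_sin_le_one _
    _ = Real.exp (-(4 * π ^ 2 * t)) := mul_one _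

/-- The shear wave does not vanish: `u(t, ¼f₀) = e^{−4π²t} e₁ ≠ 0`. -/
theorem shearWave_ne_zero (t : ℝ) : shearWave t ((1 / 4 : ℝ) • f0) ≠ 0 := by
  have hq : ((1 / 4 : ℝ) • f0) 0 = 1 / 4 := by simp [f0]
  have hsin : Real.sin (2 * π * (1 / 4 : ℝ)) = 1 := by
    rw [show 2 * π * (1 / 4 : ℝ) = π / 2 by ring, Real.sin_pi_div_two]
  have hval : shearWave t ((1 / 4 : ℝ) • f0) = Real.exp (-(4 * π ^ 2 * t)) • e1 := by
    show (Real.exp (-(4 * π ^ 2 * t)) * Real.sin (2 * π * ((1 / 4 : ℝ) • f0) 0)) • e1 = _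
    rw [hq, hsin, mul_one]
  rw [hval, Ne, smul_eq_zero, not_or]
  exact ⟨(Real.exp_pos _).ne', e1_ne_zero⟩

/-- **The shear wave satisfies the KNSS/Oseen integral equation between ANY two times `s < t`.**
Heat part: `heatExtension_shear`; Duhamel part: the tensor `u ⊗ u = g² e₁ ⊗ e₁` with `g`
independent of `y₁` has `∂₁`-divergence zero, so `∫ K(t−τ, x−y)[u, u] dy = 0`
(`integral_oseenKernel_sub_smul_single_left`, Fubini along the lines parallel to `e₁`). -/
theorem shearWave_mild (s t : ℝ) (hst : s < t) (x : (EuclideanSpace ℝ (Fin 3))) :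
    shearWave t x = heatFlow (shearWave s) (t - s) x -
      ∫ τ in Set.Ioo s t, ∫ y, oseenKernel (t - τ) (x - y) (shearWave τ y) (shearWave τ y) := by
  have hσ : 0 < t - s := sub_pos.2 hst
  have hD : ∫ τ in Set.Ioo s t, ∫ y, oseenKernel (t - τ) (x - y) (shearWave τ y) (shearWave τ y) =
      0 := by
    refine setIntegral_eq_zero_of_forall_eq_zero fun τ hτ => ?_
    have hτ' : 0 < t - τ := sub_pos.2 hτ.2
    have hg : Continuous fun y : (EuclideanSpace ℝ (Fin 3)) => Real.exp (-(4 * π ^ 2 * τ)) * Real.sin (2 * π * y 0) :=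
      continuous_const.mul (Real.continuous_sin.comp (continuous_const.mul continuous_coord0))
    have hc : Continuous (shearWave τ) := hg.smul continuous_const
    have key := integral_oseenKernel_sub_smul_single_left hτ'
      (g := fun y : (EuclideanSpace ℝ (Fin 3)) => Real.exp (-(4 * π ^ 2 * τ)) * Real.sin (2 * π * y 0))
      (c := shearWave τ) hg.aestronglyMeasurable hc.aestronglyMeasurable
      (Mg := Real.exp (-(4 * π ^ 2 * τ))) (Mc := Real.exp (-(4 * π ^ 2 * τ)))
      (fun y => ?_) (fun y => norm_shearWave_le τ y) (fun y δ => ?_) (fun y δ => ?_) x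
    · simpa [shearWave, e1] using key
    · rw [abs_mul, abs_of_pos (Real.exp_pos _)]
      calc Real.exp (-(4 * π ^ 2 * τ)) * |Real.sin (2 * π * y 0)|
          ≤ Real.exp (-(4 * π ^ 2 * τ)) * 1 := by gcongr; exact Real.abs_sin_le_one _
        _ = Real.exp (-(4 * π ^ 2 * τ)) := mul_one _
    · simp
    · simp [shearWave]
  rw [hD, sub_zero, heatFlow_of_pos _ hσ]
  have hs : shearWave s = fun y : (EuclideanSpace ℝ (Fin 3)) =>
      (Real.exp (-(4 * π ^ 2 * s)) * Real.sin (2 * π * y 0)) • e1 := rfl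
  rw [hs, heatExtension_shear hσ]
  simp only [shearWave]
  congr 1
  rw [← Real.exp_add]
  ring_nf

/-! ### The window mutant and its refutation -/

/-- The crux with "ancient" weakened to a FINITE backward window `(−T, 0)`: the four class
hypotheses and the symmetry are assumed, and the conclusion asserted, only for times in
`(−T, 0)` (the Oseen integral equation between all `−T < s < t < 0`). -/
def SymmetricLiouvilleOnWindow (T : ℝ) : Prop :=
  ∀ (C : ℝ) (u : ℝ → (EuclideanSpace ℝ (Fin 3)) → (EuclideanSpace ℝ (Fin 3))),
    ContDiffOn ℝ (⊤ : ℕ∞) (Function.uncurry u) (Set.Ioo (-T) 0 ×ˢ Set.univ) →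
    (∀ t ∈ Set.Ioo (-T) 0, VectorCalculus.IsDivFree (u t)) →
    (∀ s t : ℝ, -T < s → s < t → t < 0 → ∀ x, u t x = heatFlow (u s) (t - s) x -
        ∫ τ in Set.Ioo s t, ∫ y, oseenKernel (t - τ) (x - y) (u τ y) (u τ y)) →
    (∀ t ∈ Set.Ioo (-T) 0, ∀ x, ‖u t x‖ ≤ C / Real.sqrt (-t)) →
    ∀ (a : (EuclideanSpace ℝ (Fin 3))) (σ : ℝ) (A : (EuclideanSpace ℝ (Fin 3)) →L[ℝ] (EuclideanSpace ℝ (Fin 3))), (∀ x, ⟪A x, x⟫ = 0) → ¬ (a = 0 ∧ σ = 0 ∧ A = 0) →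
      (∀ t ∈ Set.Ioo (-T) 0, ∀ x, fderiv ℝ (u t) x (a + σ • x + A x) + σ • u t x +
        (2 * σ * t) • timeDeriv u t x - A (u t x) = 0) →
      ∀ t ∈ Set.Ioo (-T) 0, ∀ x, u t x = 0

/-- **"Ancient" is load-bearing**: on every finite backward window the crux is FALSE. Witness:
the viscous shear wave `e^{−4π²t} sin(2π y₀) e₁`, which on `(−T, 0)` is smooth, divergence free,
KNSS-mild between any two times, Type-I with `C = e^{4π²T}√T` (it is bounded by `e^{4π²T}` there,
and `√(−t) ≤ √T`), translation invariant along `e₁`, and nonzero. It is NOT a counterexample to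
the crux because it grows like `e^{4π²|t|}` as `t → −∞`: any proof must use the behaviour of `u`
for `t → −∞` (the Type-I bound GLOBALLY in time), not just the equation and the rate near `t = 0`. -/
theorem symmetricLiouville_false_on_window {T : ℝ} (hT : 0 < T) : ¬ SymmetricLiouvilleOnWindow T := by
  intro h
  have hT2 : -T / 2 ∈ Set.Ioo (-T) 0 := ⟨by linarith, by linarith⟩
  refine shearWave_ne_zero (-T / 2) (h (Real.exp (4 * π ^ 2 * T) * Real.sqrt T) shearWave
    shearWave_contDiff.contDiffOn (fun t _ => shearWave_divFree t)
    (fun s t _ hst _ x => shearWave_mild s t hst x) ?_ e1 0 0 (fun x => by simp)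
    (fun hz => ?_) (fun t _ y => shearWave_symm t y) (-T / 2) hT2 _)
  · rintro t ⟨ht1, ht2⟩ y
    have hst : 0 < Real.sqrt (-t) := Real.sqrt_pos.2 (by linarith)
    have hsT : Real.sqrt (-t) ≤ Real.sqrt T := Real.sqrt_le_sqrt (by linarith)
    have hTpos : 0 < Real.sqrt T := Real.sqrt_pos.2 hT
    calc ‖shearWave t y‖ ≤ Real.exp (-(4 * π ^ 2 * t)) := norm_shearWave_le t y
      _ ≤ Real.exp (4 * π ^ 2 * T) := Real.exp_le_exp.2 (by nlinarith [Real.pi_pos])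
      _ = Real.exp (4 * π ^ 2 * T) * Real.sqrt T / Real.sqrt T := by
          field_simp
      _ ≤ Real.exp (4 * π ^ 2 * T) * Real.sqrt T / Real.sqrt (-t) :=
          div_le_div_of_nonneg_left (by positivity) hst hsT
  · have := norm_e1
    rw [hz.1, norm_zero] at this
    exact zero_ne_one this

end Summit.NavierStokesRegularity.NavierStokesRegularity.Theorems.SymmetricLiouville.Negative

end
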